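/-
VALUE = THEOREM (the split orbit sums of the all-`p` reflection-class certificate), NOT summit
progress (cell b2b-lgcu-borel, gen 24); the crux item stmt-MatrixMultiplication-14079 is untouched.
-/
import Mathlib
import Literature.NumberTheory.EllipticCurves.BinaryQuarticDiscriminantFpCountProofs
import Summits.MatrixMultiplication.MatrixMultiplication.Theorems.SubgroupIdentityDesigns.Negative.ReflectionClassCharSums
import Summits.MatrixMultiplication.MatrixMultiplication.Theorems.SubgroupIdentityDesigns.Negative.ReflectionClassPlane

/-!
# Split orbit sums of the unified weight vanish (non-matching case), for every odd prime `p`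

VALUE = THEOREM (generic in the odd prime `p`), NOT summit progress; the crux item
stmt-MatrixMultiplication-14079 is untouched and remains open.

Layer F6b of the all-`p` proof of the unified reflection-class certificate (ORACLE-g24 §G24-1 (S2),
§G24-2).  Level `c` with `−c` a non-square, `X₀, ω` on the sphere `Q = c`, `x` ANISOTROPIC
(`q = Q(x) ≠ 0`), `W = x^⊥`, `w₁ = x × ω` (so `w₁ ∈ W`, `w₁ ⊥ ω`, `Q(w₁) = q Q(ω_W)`), and the
NON-MATCHING hypothesis `χ(c · Q(w₁)) = −1` (the line `W ∩ ω^⊥` is not of the class of `c`).  Then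

  `orbitS_sum :  Σ_{z ∈ W} χ(Q z) · wt c X₀ (R_z ω) = 0`,

the sum over all vectors `z ⊥ x` of the class sign `χ(Q z)` times the weight of the reflected point
(isotropic and zero `z` carry the factor `χ(0) = 0`).  In the successor layers the twisted
stabiliser of `x` in the class group is `{R_z R_{w₁}} ⊔ {mirrors R_z}` over the class-`c` lines `z`
of `W`; in the matching case the two halves cancel termwise, in the non-matching case their
difference is `(p − 1)⁻¹ χ(c)` times this sum.
Proof (ORACLE-g24 (S2)): in the frame `w₁, w₂ = x × w₁` of `W` (`ReflectionClassPlane`) the weight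
of `R_z ω`, times `χ(Q z)`, is a combination of `χ` of three binary quadratic forms in the frame
coordinates plus `p`·(pole indicators) (`term`); the forms have discriminants `−4c(x·ω ∓ x·X₀)²`,
`4c(qc − (x·ω)² − (x·X₀)²)` and are summed by `ReflectionClassCharSums.sum_bqf_eq_zero /
sum_bqf_rank_one`; the poles sit on the line through `ω ∓ X₀` (`package`).
HONEST SCOPE.  One of the two orbit types, non-matching case; by itself it excludes nothing.
-/

set_option linter.dupNamespace false

open scoped BigOperators Matrix

namespace Summit.MatrixMultiplication.MatrixMultiplication.Theorems.SubgroupIdentityDesigns.Negative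
namespace ReflectionClassOrbitS

open ReflectionClassCertificate (V chi wt)
open NonsquareReflections (reflMat reflMat_mulVec)
open ReflectionClassSphere (wt_eq_lat lat chi_eq eq_base_iff eq_neg_base_iff dot_sub_self)
open ReflectionClassCharSums (sum_sq sum_bqf_eq_zero sum_bqf_rank_one)
open ReflectionClassPlane
open Literature.NumberTheory.EllipticCurves.BinaryQuartic (two_ne_zero_zmod)

variable {p : ℕ} [hp : Fact p.Prime]

/-- A binary quadratic form `α u² + β u v + γ v²` in the frame coordinates. -/
def mform (α β γ u v : ZMod p) : ZMod p := α * u ^ 2 + β * u * v + γ * v ^ 2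

/-- `χ(−1)² = 1`. -/
theorem chi_neg_one_sq : quadraticChar (ZMod p) (-1) * quadraticChar (ZMod p) (-1) = 1 := by
  rw [← map_mul, neg_one_mul, neg_neg, map_one]

section Term

variable {c : ZMod p} {X₀ ω x : V p}

/-- **TERMWISE FORM.**  For `z = u w₁ + v w₂ ∈ x^⊥`:  `χ(Q z) · wt c X₀ (R_z ω)` is
`χ(2Q(w₁))·[χ(−1)(χ(m₊) − χ(m₋)) + (1 − χ(−1)) χ(m₀)]` plus `p χ(Q z)([R_z ω = X₀] − [R_z ω = −X₀])`
with the binary forms `m₊, m₋, m₀` below (`t₀ = ω·X₀`, `y_i = w_i·X₀`, `q = Q x`). -/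
theorem term (hc : ¬ IsSquare (-c)) (hX : X₀ ⬝ᵥ X₀ = c) (hω : ω ⬝ᵥ ω = c)
    (hQ : w₁ x ω ⬝ᵥ w₁ x ω ≠ 0) (u v : ZMod p) :
    quadraticChar (ZMod p) ((u • w₁ x ω + v • w₂ x ω) ⬝ᵥ (u • w₁ x ω + v • w₂ x ω)) *
        wt c X₀ (reflMat (u • w₁ x ω + v • w₂ x ω) *ᵥ ω) =
      quadraticChar (ZMod p) (2 * (w₁ x ω ⬝ᵥ w₁ x ω)) *
          (quadraticChar (ZMod p) (-1) *
              (quadraticChar (ZMod p) (mform (c + ω ⬝ᵥ X₀) (2 * (w₁ x ω ⬝ᵥ X₀))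
                  ((c + ω ⬝ᵥ X₀) * (x ⬝ᵥ x) + 2 * (w₂ x ω ⬝ᵥ X₀)) u v) -
                quadraticChar (ZMod p) (mform (c - ω ⬝ᵥ X₀) (-2 * (w₁ x ω ⬝ᵥ X₀))
                  ((c - ω ⬝ᵥ X₀) * (x ⬝ᵥ x) - 2 * (w₂ x ω ⬝ᵥ X₀)) u v)) +
            (1 - quadraticChar (ZMod p) (-1)) *
              quadraticChar (ZMod p) (mform (ω ⬝ᵥ X₀) (2 * (w₁ x ω ⬝ᵥ X₀))
                ((ω ⬝ᵥ X₀) * (x ⬝ᵥ x) + 2 * (w₂ x ω ⬝ᵥ X₀)) u v)) +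
        (p : ℤ) *
          (quadraticChar (ZMod p) ((u • w₁ x ω + v • w₂ x ω) ⬝ᵥ (u • w₁ x ω + v • w₂ x ω)) *
              (if reflMat (u • w₁ x ω + v • w₂ x ω) *ᵥ ω = X₀ then 1 else 0) -
            quadraticChar (ZMod p) ((u • w₁ x ω + v • w₂ x ω) ⬝ᵥ (u • w₁ x ω + v • w₂ x ω)) *
              (if reflMat (u • w₁ x ω + v • w₂ x ω) *ᵥ ω = -X₀ then 1 else 0)) := by
  obtain ⟨z, hz⟩ : ∃ z, z = u • w₁ x ω + v • w₂ x ω := ⟨_, rfl⟩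
  obtain ⟨q, hqd⟩ : ∃ q, q = x ⬝ᵥ x := ⟨_, rfl⟩
  obtain ⟨t₀, ht₀⟩ : ∃ t, t = ω ⬝ᵥ X₀ := ⟨_, rfl⟩
  obtain ⟨Q₁, hQ₁⟩ : ∃ Q, Q = w₁ x ω ⬝ᵥ w₁ x ω := ⟨_, rfl⟩
  obtain ⟨y₁, hy₁⟩ : ∃ y, y = w₁ x ω ⬝ᵥ X₀ := ⟨_, rfl⟩
  obtain ⟨y₂, hy₂⟩ : ∃ y, y = w₂ x ω ⬝ᵥ X₀ := ⟨_, rfl⟩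
  rw [← hz, ← hqd, ← ht₀, ← hQ₁, ← hy₁, ← hy₂]
  rw [← hQ₁] at hQ
  have hN : z ⬝ᵥ z = Q₁ * (u ^ 2 + q * v ^ 2) := by
    rw [hz, comb_dot_self, w₂_dot_self, ← hqd, ← hQ₁]; ring
  have hzω : z ⬝ᵥ ω = -(v * Q₁) := by
    rw [hz, comb_dot, w₁_dot_ω, w₂_dot_ω, ← hQ₁]; ring
  have hzX : z ⬝ᵥ X₀ = u * y₁ + v * y₂ := by rw [hz, comb_dot, ← hy₁, ← hy₂]
  have hε := chi_neg_one_sq (p := p)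
  by_cases hN0 : z ⬝ᵥ z = 0
  · -- isotropic or zero mirror vector: both sides vanish
    have huv : u ^ 2 + q * v ^ 2 = 0 := (mul_eq_zero.mp (hN ▸ hN0)).resolve_left hQ
    have e1 : mform (c + t₀) (2 * y₁) ((c + t₀) * q + 2 * y₂) u v =
        mform t₀ (2 * y₁) (t₀ * q + 2 * y₂) u v := by
      simp only [mform]; linear_combination c * huv
    have e2 : mform (c - t₀) (-2 * y₁) ((c - t₀) * q - 2 * y₂) u v =
        (-1) * mform t₀ (2 * y₁) (t₀ * q + 2 * y₂) u v := by
      simp only [mform]; linear_combination c * huv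
    rw [hN0, MulChar.map_zero, zero_mul, zero_mul, zero_mul, sub_zero, mul_zero, add_zero, e1, e2,
      show quadraticChar (ZMod p) (-1 * mform t₀ (2 * y₁) (t₀ * q + 2 * y₂) u v) =
        quadraticChar (ZMod p) (-1) * quadraticChar (ZMod p) (mform t₀ (2 * y₁) (t₀ * q + 2 * y₂) u v)
        from map_mul _ _ _]
    linear_combination (quadraticChar (ZMod p) (2 * Q₁) *
      quadraticChar (ZMod p) (mform t₀ (2 * y₁) (t₀ * q + 2 * y₂) u v)) * hε
  · -- anisotropic mirror vector: the reflected point lies on the sphere at latitude `t`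
    have hS : (reflMat z *ᵥ ω) ⬝ᵥ (reflMat z *ᵥ ω) = c := by rw [refl_dot_self, hω]
    have ht : (reflMat z *ᵥ ω) ⬝ᵥ X₀ = t₀ + 2 / (z ⬝ᵥ z) * (v * Q₁) * (u * y₁ + v * y₂) := by
      rw [refl_dot, ← ht₀, hzω, hzX]; ring
    have huv : u ^ 2 + q * v ^ 2 ≠ 0 := fun h => hN0 (by rw [hN, h, mul_zero])
    have eP : z ⬝ᵥ z * (2 * c + 2 * ((reflMat z *ᵥ ω) ⬝ᵥ X₀)) =
        (2 * Q₁) * mform (c + t₀) (2 * y₁) ((c + t₀) * q + 2 * y₂) u v := by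
      rw [ht, hN, mform]; field_simp; ring
    have eM : z ⬝ᵥ z * (2 * c - 2 * ((reflMat z *ᵥ ω) ⬝ᵥ X₀)) =
        (2 * Q₁) * mform (c - t₀) (-2 * y₁) ((c - t₀) * q - 2 * y₂) u v := by
      rw [ht, hN, mform]; field_simp; ring
    have eZ : z ⬝ᵥ z * (2 * ((reflMat z *ᵥ ω) ⬝ᵥ X₀)) =
        (2 * Q₁) * mform t₀ (2 * y₁) (t₀ * q + 2 * y₂) u v := by
      rw [ht, hN, mform]; field_simp; ring
    have f : ∀ a b : ZMod p, z ⬝ᵥ z * a = (2 * Q₁) * b →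
        quadraticChar (ZMod p) (z ⬝ᵥ z) * quadraticChar (ZMod p) a =
          quadraticChar (ZMod p) (2 * Q₁) * quadraticChar (ZMod p) b :=
      fun a b h => by rw [← map_mul, h, map_mul]
    have gP := f _ _ eP
    have gM := f _ _ eM
    have gZ := f _ _ eZ
    have i1 : ((reflMat z *ᵥ ω) ⬝ᵥ X₀ = c) ↔ reflMat z *ᵥ ω = X₀ := (eq_base_iff hc hX hS).symm
    have i2 : ((reflMat z *ᵥ ω) ⬝ᵥ X₀ = -c) ↔ reflMat z *ᵥ ω = -X₀ :=
      (eq_neg_base_iff hc hX hS).symm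
    rw [wt_eq_lat hc hX hS, lat]
    simp only [chi_eq, i1, i2]
    have expand : ∀ N E A B C P : ℤ, N * (E * (A - B) + (1 - E) * C + P) =
        E * (N * A - N * B) + (1 - E) * (N * C) + N * P := by intros; ring
    rw [expand, gP, gM, gZ]
    split_ifs <;> ring

end Term

/-! ## Pole counts -/

section Poles

variable {c : ZMod p} {X₀ ω x : V p}

/-- No `+`-poles unless `x·ω = x·X₀` (a reflection in `z ⊥ x` preserves the `x`-coordinate). -/
theorem poles_of_ne (hnm : x ⬝ᵥ ω ≠ x ⬝ᵥ X₀) :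
    ∑ z ∈ Finset.univ.filter (fun z : V p => z ⬝ᵥ x = 0),
      quadraticChar (ZMod p) (z ⬝ᵥ z) * (if reflMat z *ᵥ ω = X₀ then (1 : ℤ) else 0) = 0 := by
  refine Finset.sum_eq_zero fun z hz => ?_
  rw [if_neg, mul_zero]
  intro h
  apply hnm
  rw [dotProduct_comm x X₀, ← h, refl_dot_of_perp (Finset.mem_filter.mp hz).2, dotProduct_comm]

/-- The `+`-poles for `ω = X₀`: `Σ_{z ⊥ x} χ(Q z)[R_z ω = ω] = (p − 1) χ(Q(w₁))`
(the fixed mirrors are those through the line `w₁ = x × ω`). -/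
theorem poles_self (hp2 : p ≠ 2) (hq : x ⬝ᵥ x ≠ 0) (hQ : w₁ x ω ⬝ᵥ w₁ x ω ≠ 0) :
    ∑ z ∈ Finset.univ.filter (fun z : V p => z ⬝ᵥ x = 0),
      quadraticChar (ZMod p) (z ⬝ᵥ z) * (if reflMat z *ᵥ ω = ω then (1 : ℤ) else 0) =
        ((p : ℤ) - 1) * quadraticChar (ZMod p) (w₁ x ω ⬝ᵥ w₁ x ω) := by
  rw [sum_plane hq hQ]
  have key : ∀ u v : ZMod p,
      quadraticChar (ZMod p) ((u • w₁ x ω + v • w₂ x ω) ⬝ᵥ (u • w₁ x ω + v • w₂ x ω)) *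
        (if reflMat (u • w₁ x ω + v • w₂ x ω) *ᵥ ω = ω then (1 : ℤ) else 0) =
      if v = 0 then quadraticChar (ZMod p) (u ^ 2) * quadraticChar (ZMod p) (w₁ x ω ⬝ᵥ w₁ x ω)
        else 0 := by
    intro u v
    have hzω : (u • w₁ x ω + v • w₂ x ω) ⬝ᵥ ω = -(v * (w₁ x ω ⬝ᵥ w₁ x ω)) := by
      rw [comb_dot, w₁_dot_ω, w₂_dot_ω]; ring
    by_cases hv : v = 0
    · subst hv
      rw [if_pos rfl, if_pos (reflMat_mulVec _ _ (by rw [hzω]; ring)), mul_one, comb_dot_self,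
        ← map_mul]
      congr 1; ring
    · rw [if_neg hv]
      by_cases hN : (u • w₁ x ω + v • w₂ x ω) ⬝ᵥ (u • w₁ x ω + v • w₂ x ω) = 0
      · rw [hN, MulChar.map_zero, zero_mul]
      · rw [if_neg, mul_zero]
        rw [refl_eq_self_iff hp2 hN, hzω, neg_eq_zero]
        exact mul_ne_zero hv hQ
  simp_rw [key, Finset.sum_ite_eq', Finset.mem_univ, if_true, ← Finset.sum_mul, sum_sq]

/-- The `+`-poles for `ω ≠ X₀`, `x·ω = x·X₀`: the mirrors through the line of `ω − X₀`,
`Σ_{z ⊥ x} χ(Q z)[R_z ω = X₀] = (p − 1) χ(Q(ω − X₀))`. -/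
theorem poles_line (hp2 : p ≠ 2) (hc : ¬ IsSquare (-c)) (hX : X₀ ⬝ᵥ X₀ = c) (hω : ω ⬝ᵥ ω = c)
    (hne : ω ≠ X₀) (hnm : x ⬝ᵥ ω = x ⬝ᵥ X₀) :
    ∑ z ∈ Finset.univ.filter (fun z : V p => z ⬝ᵥ x = 0),
      quadraticChar (ZMod p) (z ⬝ᵥ z) * (if reflMat z *ᵥ ω = X₀ then (1 : ℤ) else 0) =
        ((p : ℤ) - 1) * quadraticChar (ZMod p) ((ω - X₀) ⬝ᵥ (ω - X₀)) := by
  classical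
  have hd0 : ω - X₀ ≠ 0 := sub_ne_zero.mpr hne
  have hdx : (ω - X₀) ⬝ᵥ x = 0 := by
    rw [sub_dotProduct, dotProduct_comm ω x, dotProduct_comm X₀ x, hnm, sub_self]
  have ht : ω ⬝ᵥ X₀ ≠ c := fun h => hne ((eq_base_iff hc hX hω).mpr h)
  -- the punctured line `T = {s (ω − X₀) : s ≠ 0}`
  set T : Finset (V p) := (Finset.univ.filter fun s : ZMod p => s ≠ 0).image fun s => s • (ω - X₀)
    with hT
  have hTW : T ⊆ Finset.univ.filter (fun z : V p => z ⬝ᵥ x = 0) := by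
    intro z hz
    obtain ⟨s, -, rfl⟩ := Finset.mem_image.mp hz
    simp only [Finset.mem_filter, Finset.mem_univ, true_and, smul_dotProduct, hdx, smul_zero]
  have hcardT : T.card = p - 1 := by
    rw [hT, Finset.card_image_of_injective _ (smul_left_injective (ZMod p) hd0),
      Finset.filter_ne' Finset.univ (0 : ZMod p), Finset.card_erase_of_mem (Finset.mem_univ _),
      Finset.card_univ, ZMod.card]
  have key : ∀ z ∈ Finset.univ.filter (fun z : V p => z ⬝ᵥ x = 0),
      quadraticChar (ZMod p) (z ⬝ᵥ z) * (if reflMat z *ᵥ ω = X₀ then (1 : ℤ) else 0) =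
        if z ∈ T then quadraticChar (ZMod p) ((ω - X₀) ⬝ᵥ (ω - X₀)) else 0 := by
    intro z _
    by_cases hzT : z ∈ T
    · obtain ⟨s, hs, rfl⟩ := Finset.mem_image.mp hzT
      have hs0 : s ≠ 0 := (Finset.mem_filter.mp hs).2
      rw [if_pos hzT, if_pos (by rw [refl_smul hs0, refl_sub_apply hp2 hω hX ht]), mul_one,
        smul_dotProduct, dotProduct_smul, smul_eq_mul, smul_eq_mul, ← mul_assoc, ← sq, map_mul,
        quadraticChar_sq_one' hs0, one_mul]
    · rw [if_neg hzT]
      by_cases hR : reflMat z *ᵥ ω = X₀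
      · exfalso
        obtain ⟨s, hs0, rfl⟩ := eq_smul_sub_of_refl_eq hne hR
        exact hzT (Finset.mem_image.mpr ⟨s, Finset.mem_filter.mpr ⟨Finset.mem_univ _, hs0⟩, rfl⟩)
      · rw [if_neg hR, mul_zero]
  rw [Finset.sum_congr rfl key, Finset.sum_ite_mem, Finset.inter_eq_right.mpr hTW,
    Finset.sum_const, hcardT, nsmul_eq_mul, Nat.cast_sub hp.out.one_lt.le, Nat.cast_one]

end Poles

/-! ## The pole package and the main theorem -/

section Main

variable {c : ZMod p} {X₀ ω x : V p}

/-- Non-matching ⇒ `χ(Q(w₁)) = χ(−1)` (from `χ(−c) = −1 = χ(c Q(w₁))`). -/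
theorem chi_w₁ (hc : ¬ IsSquare (-c))
    (hnm : quadraticChar (ZMod p) (c * (w₁ x ω ⬝ᵥ w₁ x ω)) = -1) :
    quadraticChar (ZMod p) (w₁ x ω ⬝ᵥ w₁ x ω) = quadraticChar (ZMod p) (-1) := by
  have hc0 : c ≠ 0 := by
    rintro rfl; rw [zero_mul, MulChar.map_zero] at hnm; norm_num at hnm
  have h1 : quadraticChar (ZMod p) (-1) * quadraticChar (ZMod p) c = -1 := by
    rw [← map_mul, neg_one_mul]; exact (quadraticChar_neg_one_iff_not_isSquare).mpr hc
  have h2 : quadraticChar (ZMod p) c * quadraticChar (ZMod p) (w₁ x ω ⬝ᵥ w₁ x ω) = -1 := by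
    rw [← map_mul]; exact hnm
  rcases quadraticChar_dichotomy hc0 with h | h <;> rw [h] at h1 h2 <;> linarith

/-- Discriminant of the `−`-form: `−4c (x·ω − x·X₀)²` (Gram identity `triple_sq`). -/
theorem disc_minus (hX : X₀ ⬝ᵥ X₀ = c) (hω : ω ⬝ᵥ ω = c) :
    (-2 * (w₁ x ω ⬝ᵥ X₀)) ^ 2 -
        4 * (c - ω ⬝ᵥ X₀) * ((c - ω ⬝ᵥ X₀) * (x ⬝ᵥ x) - 2 * (w₂ x ω ⬝ᵥ X₀)) =
      -4 * c * (x ⬝ᵥ ω - x ⬝ᵥ X₀) ^ 2 := by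
  have hG := triple_sq (x := x) (ω := ω) X₀
  rw [hω, hX] at hG
  rw [w₂_dot]
  linear_combination 4 * hG

/-- Discriminant of the zonal form: `4c (Q(x) c − (x·X₀)² − (x·ω)²)`. -/
theorem disc_zero (hX : X₀ ⬝ᵥ X₀ = c) (hω : ω ⬝ᵥ ω = c) :
    (2 * (w₁ x ω ⬝ᵥ X₀)) ^ 2 -
        4 * (ω ⬝ᵥ X₀) * ((ω ⬝ᵥ X₀) * (x ⬝ᵥ x) + 2 * (w₂ x ω ⬝ᵥ X₀)) =
      4 * c * ((x ⬝ᵥ x) * c - (x ⬝ᵥ X₀) ^ 2 - (x ⬝ᵥ ω) ^ 2) := by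
  have hG := triple_sq (x := x) (ω := ω) X₀
  rw [hω, hX] at hG
  rw [w₂_dot]
  linear_combination 4 * hG

/-- **POLE PACKAGE.**  `χ(−1) χ(2Q(w₁)) · Σ_{u,v} χ(m₋(u,v)) = p · Σ_{z ⊥ x} χ(Q z)[R_z ω = X₀]`:
the `−`-form has discriminant `−4c(x·ω − x·X₀)²`, so both sides vanish unless `x·ω = x·X₀`,
and then the form has rank one and the poles fill the punctured line through `ω − X₀`
(resp. through `w₁` when `ω = X₀`). -/
theorem package (hp2 : p ≠ 2) (hc : ¬ IsSquare (-c)) (hX : X₀ ⬝ᵥ X₀ = c) (hω : ω ⬝ᵥ ω = c)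
    (hq : x ⬝ᵥ x ≠ 0) (hnm : quadraticChar (ZMod p) (c * (w₁ x ω ⬝ᵥ w₁ x ω)) = -1) :
    quadraticChar (ZMod p) (-1) * quadraticChar (ZMod p) (2 * (w₁ x ω ⬝ᵥ w₁ x ω)) *
        ∑ u : ZMod p, ∑ v : ZMod p, quadraticChar (ZMod p)
          (mform (c - ω ⬝ᵥ X₀) (-2 * (w₁ x ω ⬝ᵥ X₀))
            ((c - ω ⬝ᵥ X₀) * (x ⬝ᵥ x) - 2 * (w₂ x ω ⬝ᵥ X₀)) u v) =
      (p : ℤ) * ∑ z ∈ Finset.univ.filter (fun z : V p => z ⬝ᵥ x = 0),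
        quadraticChar (ZMod p) (z ⬝ᵥ z) * (if reflMat z *ᵥ ω = X₀ then (1 : ℤ) else 0) := by
  have hcQ : c * (w₁ x ω ⬝ᵥ w₁ x ω) ≠ 0 := by
    intro h; rw [h, MulChar.map_zero] at hnm; norm_num at hnm
  have hc0 : c ≠ 0 := left_ne_zero_of_mul hcQ
  have hQ : w₁ x ω ⬝ᵥ w₁ x ω ≠ 0 := right_ne_zero_of_mul hcQ
  have h2 : (2 : ZMod p) ≠ 0 := two_ne_zero_zmod hp2
  have hε := chi_neg_one_sq (p := p)
  have hχQ := chi_w₁ hc hnm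
  simp only [mform]
  by_cases hnm' : x ⬝ᵥ ω = x ⬝ᵥ X₀
  · have hD : (-2 * (w₁ x ω ⬝ᵥ X₀)) ^ 2 -
        4 * (c - ω ⬝ᵥ X₀) * ((c - ω ⬝ᵥ X₀) * (x ⬝ᵥ x) - 2 * (w₂ x ω ⬝ᵥ X₀)) = 0 := by
      rw [disc_minus hX hω, hnm', sub_self]; ring
    by_cases hωX : ω = X₀
    · -- `ω = X₀`: the form is `2Q(w₁) v²`, the poles are the mirrors through `w₁`
      subst hωX
      have hv : (c - ω ⬝ᵥ ω) * 0 ^ 2 + (-2 * (w₁ x ω ⬝ᵥ ω)) * 0 * 1 +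
          ((c - ω ⬝ᵥ ω) * (x ⬝ᵥ x) - 2 * (w₂ x ω ⬝ᵥ ω)) * 1 ^ 2 ≠ 0 := by
        rw [hω, w₂_dot_ω]; ring_nf; exact mul_ne_zero hQ h2
      rw [sum_bqf_rank_one hp2 hD hv, poles_self hp2 hq hQ, hω, w₁_dot_ω, w₂_dot_ω, hχQ,
        show (c - c) * (0 : ZMod p) ^ 2 + (-2 * 0) * 0 * 1 +
          ((c - c) * (x ⬝ᵥ x) - 2 * -(w₁ x ω ⬝ᵥ w₁ x ω)) * 1 ^ 2 = 2 * (w₁ x ω ⬝ᵥ w₁ x ω) by ring]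
      have h1 := quadraticChar_sq_one (mul_ne_zero h2 hQ)
      linear_combination ((p : ℤ) * ((p : ℤ) - 1) * quadraticChar (ZMod p) (-1)) * h1
    · -- `ω ≠ X₀`: the form is `(c − t₀)·(square of a linear form)`, poles on the line `ω − X₀`
      have ht : ω ⬝ᵥ X₀ ≠ c := fun h => hωX ((eq_base_iff hc hX hω).mpr h)
      have hv : (c - ω ⬝ᵥ X₀) * 1 ^ 2 + (-2 * (w₁ x ω ⬝ᵥ X₀)) * 1 * 0 +
          ((c - ω ⬝ᵥ X₀) * (x ⬝ᵥ x) - 2 * (w₂ x ω ⬝ᵥ X₀)) * 0 ^ 2 ≠ 0 := by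
        ring_nf; exact sub_ne_zero.mpr (Ne.symm ht)
      rw [sum_bqf_rank_one hp2 hD hv, poles_line hp2 hc hX hω hωX hnm', dot_sub_self hX hω,
        show (c - ω ⬝ᵥ X₀) * (1 : ZMod p) ^ 2 + (-2 * (w₁ x ω ⬝ᵥ X₀)) * 1 * 0 +
          ((c - ω ⬝ᵥ X₀) * (x ⬝ᵥ x) - 2 * (w₂ x ω ⬝ᵥ X₀)) * 0 ^ 2 = c - ω ⬝ᵥ X₀ by ring,
        show (2 : ZMod p) * c - 2 * (ω ⬝ᵥ X₀) = 2 * (c - ω ⬝ᵥ X₀) by ring, map_mul, map_mul, hχQ]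
      linear_combination ((p : ℤ) * ((p : ℤ) - 1) * quadraticChar (ZMod p) 2 *
        quadraticChar (ZMod p) (c - ω ⬝ᵥ X₀)) * hε
  · -- `x·ω ≠ x·X₀`: no poles, non-degenerate form
    have h4 : (-4 : ZMod p) ≠ 0 := by
      rw [show (-4 : ZMod p) = -(2 * 2) by norm_num]; exact neg_ne_zero.mpr (mul_ne_zero h2 h2)
    rw [poles_of_ne hnm', mul_zero, sum_bqf_eq_zero hp2, mul_zero]
    rw [disc_minus hX hω]
    exact mul_ne_zero (mul_ne_zero h4 hc0) (pow_ne_zero 2 (sub_ne_zero.mpr hnm'))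

/-- **SPLIT ORBIT SUMS VANISH (non-matching case)** (ORACLE-g24 §G24-1 (S2)): for every odd
prime `p`, level `c` with `−c` a non-square, `X₀, ω` on the sphere `Q = c`, anisotropic `x` with
`χ(c · Q(x × ω)) = −1`:  `Σ_{z ⊥ x} χ(Q z) · wt c X₀ (R_z ω) = 0`. -/
theorem orbitS_sum (hp2 : p ≠ 2) (hc : ¬ IsSquare (-c)) (hX : X₀ ⬝ᵥ X₀ = c) (hω : ω ⬝ᵥ ω = c)
    (hq : x ⬝ᵥ x ≠ 0) (hnm : quadraticChar (ZMod p) (c * (w₁ x ω ⬝ᵥ w₁ x ω)) = -1) :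
    ∑ z ∈ Finset.univ.filter (fun z : V p => z ⬝ᵥ x = 0),
      quadraticChar (ZMod p) (z ⬝ᵥ z) * wt c X₀ (reflMat z *ᵥ ω) = 0 := by
  have hcQ : c * (w₁ x ω ⬝ᵥ w₁ x ω) ≠ 0 := by
    intro h; rw [h, MulChar.map_zero] at hnm; norm_num at hnm
  have hQ : w₁ x ω ⬝ᵥ w₁ x ω ≠ 0 := right_ne_zero_of_mul hcQ
  have hX' : (-X₀) ⬝ᵥ (-X₀) = c := by rw [neg_dotProduct, dotProduct_neg, neg_neg, hX]
  have hP := package hp2 hc hX hω hq hnm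
  have hM := package hp2 hc hX' hω hq hnm
  simp only [dotProduct_neg, sub_neg_eq_add, mul_neg, neg_mul, neg_neg] at hM
  have hPole : ∀ Y : V p, ∑ u : ZMod p, ∑ v : ZMod p,
      quadraticChar (ZMod p) ((u • w₁ x ω + v • w₂ x ω) ⬝ᵥ (u • w₁ x ω + v • w₂ x ω)) *
        (if reflMat (u • w₁ x ω + v • w₂ x ω) *ᵥ ω = Y then (1 : ℤ) else 0) =
      ∑ z ∈ Finset.univ.filter (fun z : V p => z ⬝ᵥ x = 0),
        quadraticChar (ZMod p) (z ⬝ᵥ z) * (if reflMat z *ᵥ ω = Y then (1 : ℤ) else 0) := by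
    intro Y; rw [sum_plane hq hQ]
  rw [sum_plane hq hQ]
  simp_rw [term hc hX hω hQ]
  simp only [Finset.sum_add_distrib, Finset.sum_sub_distrib, ← Finset.mul_sum]
  rw [hPole X₀, hPole (-X₀)]
  rcases quadraticChar_dichotomy (neg_ne_zero.mpr (one_ne_zero : (1 : ZMod p) ≠ 0)) with hε | hε
  · rw [hε] at hP hM ⊢; linear_combination hM - hP
  · -- `χ(−1) = −1`: the zonal form is non-degenerate, its sum vanishes
    have hS₀ : ∑ u : ZMod p, ∑ v : ZMod p, quadraticChar (ZMod p)
        (mform (ω ⬝ᵥ X₀) (2 * (w₁ x ω ⬝ᵥ X₀))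
          ((ω ⬝ᵥ X₀) * (x ⬝ᵥ x) + 2 * (w₂ x ω ⬝ᵥ X₀)) u v) = 0 := by
      simp only [mform]
      refine sum_bqf_eq_zero hp2 ?_
      rw [disc_zero hX hω]
      have h4 : (4 : ZMod p) ≠ 0 := by
        rw [show (4 : ZMod p) = 2 * 2 by norm_num]
        exact mul_ne_zero (two_ne_zero_zmod hp2) (two_ne_zero_zmod hp2)
      refine mul_ne_zero (mul_ne_zero h4 (left_ne_zero_of_mul hcQ)) fun h0 => ?_
      have hχQ := chi_w₁ hc hnm
      rw [w₁_dot_self, hω, hε, show (x ⬝ᵥ x) * c - (x ⬝ᵥ ω) ^ 2 = (x ⬝ᵥ X₀) ^ 2 by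
        linear_combination h0] at hχQ
      by_cases hm : x ⬝ᵥ X₀ = 0
      · rw [hm, zero_pow two_ne_zero, MulChar.map_zero] at hχQ; norm_num at hχQ
      · rw [quadraticChar_sq_one' hm] at hχQ; norm_num at hχQ
    rw [hε] at hP hM ⊢; rw [hS₀]; linear_combination hM - hP

end Main

end ReflectionClassOrbitS
end Summit.MatrixMultiplication.MatrixMultiplication.Theorems.SubgroupIdentityDesigns.Negative
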